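import Mathlib
import Literature.MathematicalPhysics.StatisticalMechanics.Crystallization

/-!
# Windows return to the finite configurations (stub `stub_windowsReturn` of crux
# `HcpDiffractionRigidity`, item `stmt-AtomisticToContinuum-13166`, line `registered`)

**Pure metric bookkeeping (stub B3 of Half B).**  Finite configurations `z k` converge locally
to a set `Λ` (two-way `ε`-matching on every ball about `0`, eventually in `k`), and `Λ` contains,
for every radius `R` and tolerance `ε`, a translated window (centre `c`) two-way `ε`-matched with
a fixed set `S` (the point set of a periodic configuration `Q`; only `S : Set E` is used).  Then
along a subsequence `κ` and after the translations `σ l = -c l` the `z (κ l)` are eventually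
two-way `ε`-matched with `S` on every ball.

Stage `l`: window radius `l + 1`, tolerance `1/(l+1)`, window centre `c l`; local convergence is
used at radius `‖c l‖ + l + 1` and tolerance `1/(l+1)`, and the subsequence is extracted with
`Filter.extraction_forall_of_eventually`.  The verification is two triangle inequalities
(`HcpRigidityWindowsReturn.dist_sub_le_dist_add_dist` and the two norm bounds).  The statement is
proved for an arbitrary seminormed additive commutative group and arbitrary index types
(`HcpRigidityWindowsReturn.windowsReturn_core`) and then specialised.  All `[folklore]`.
-/

noncomputable section

namespace Summit.AtomisticToContinuum.Crystallization.Theorems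

open Filter
open scoped BigOperators Classical
open Literature.MathematicalPhysics.StatisticalMechanics

namespace HcpRigidityWindowsReturn

variable {E : Type*} [SeminormedAddCommGroup E]

/-- Triangle inequality through a common translate:
`dist (a - c) s ≤ dist a p + dist (p - c) s`. [folklore] -/
theorem dist_sub_le_dist_add_dist (a p c s : E) :
    dist (a - c) s ≤ dist a p + dist (p - c) s := by
  calc dist (a - c) s ≤ dist (a - c) (p - c) + dist (p - c) s := dist_triangle _ _ _
    _ = dist a p + dist (p - c) s := by rw [dist_sub_right]

/-- `‖p‖ ≤ ‖c‖ + ‖s‖ + dist (p - c) s`. [folklore] -/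
theorem norm_le_norm_add_norm_add_dist_sub (p c s : E) :
    ‖p‖ ≤ ‖c‖ + ‖s‖ + dist (p - c) s := by
  have h1 : ‖p‖ ≤ ‖c‖ + ‖p - c‖ := norm_le_norm_add_norm_sub' p c
  have h2 : ‖p - c‖ ≤ dist (p - c) s + ‖s‖ := by
    calc ‖p - c‖ = ‖(p - c - s) + s‖ := by rw [sub_add_cancel]
      _ ≤ ‖p - c - s‖ + ‖s‖ := norm_add_le _ _
      _ = dist (p - c) s + ‖s‖ := by rw [dist_eq_norm]
  linarith

/-- `‖p - c‖ ≤ dist a p + ‖a - c‖`. [folklore] -/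
theorem norm_sub_le_dist_add_norm_sub (p a c : E) : ‖p - c‖ ≤ dist a p + ‖a - c‖ := by
  calc ‖p - c‖ = dist (p - c) 0 := (dist_zero_right _).symm
    _ ≤ dist (p - c) (a - c) + dist (a - c) 0 := dist_triangle _ _ _
    _ = dist a p + ‖a - c‖ := by rw [dist_sub_right, dist_comm, dist_zero_right]

/-- `‖a‖ ≤ ‖a - c‖ + ‖c‖`. [folklore] -/
theorem norm_le_norm_sub_add_norm (a c : E) : ‖a‖ ≤ ‖a - c‖ + ‖c‖ := by
  have := norm_le_norm_add_norm_sub' a c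
  linarith

/-- **Windows return, abstract form.**  If configurations `z k : ι k → E` converge locally to
`Λ` (two-way `ε`-matching on balls about `0`, eventually in `k`) and `Λ` has, for every radius
and tolerance, a translated window two-way matched with a set `S`, then along a strictly
increasing `κ` and after translations `σ` the configurations `z (κ l) · + σ l` are eventually
two-way `ε`-matched with `S` on every ball. [folklore] -/
theorem windowsReturn_core {ι : ℕ → Type*} (z : (k : ℕ) → ι k → E) (Λ S : Set E)
    (hloc : ∀ R ε : ℝ, 0 < ε → ∀ᶠ k : ℕ in Filter.atTop,
      (∀ p ∈ Λ, ‖p‖ ≤ R → ∃ i : ι k, dist (z k i) p ≤ ε) ∧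
      (∀ i : ι k, ‖z k i‖ ≤ R → ∃ p ∈ Λ, dist (z k i) p ≤ ε))
    (hwin : ∀ R ε : ℝ, 0 < ε → ∃ c : E,
      (∀ s ∈ S, ‖s‖ ≤ R → ∃ p ∈ Λ, dist (p - c) s ≤ ε) ∧
      (∀ p ∈ Λ, ‖p - c‖ ≤ R → ∃ s ∈ S, dist (p - c) s ≤ ε)) :
    ∃ (κ : ℕ → ℕ) (σ : ℕ → E), StrictMono κ ∧ ∀ R ε : ℝ, 0 < ε →
      ∀ᶠ k : ℕ in Filter.atTop,
        (∀ s ∈ S, ‖s‖ ≤ R → ∃ i : ι (κ k), dist (z (κ k) i + σ k) s ≤ ε) ∧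
        (∀ i : ι (κ k), ‖z (κ k) i + σ k‖ ≤ R → ∃ s ∈ S, dist (z (κ k) i + σ k) s ≤ ε) := by
  -- stage tolerances `e l = 1/(l+1)`
  set e : ℕ → ℝ := fun l => 1 / ((l : ℝ) + 1) with he
  have he_pos : ∀ l, 0 < e l := fun l => by
    simp only [he]
    exact Nat.one_div_pos_of_nat
  have he_le_one : ∀ l, e l ≤ 1 := fun l => by
    simp only [he]
    rw [div_le_one (Nat.cast_add_one_pos l)]
    linarith [(l.cast_nonneg : (0 : ℝ) ≤ l)]
  -- window centres `c l` at radius `l + 1`, tolerance `e l`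
  choose c hc using fun l : ℕ => hwin ((l : ℝ) + 1) (e l) (he_pos l)
  -- local convergence at radius `‖c l‖ + l + 1`, tolerance `e l`, along a subsequence
  have hP : ∀ l : ℕ, ∀ᶠ k : ℕ in Filter.atTop,
      (∀ p ∈ Λ, ‖p‖ ≤ ‖c l‖ + l + 1 → ∃ i : ι k, dist (z k i) p ≤ e l) ∧
      (∀ i : ι k, ‖z k i‖ ≤ ‖c l‖ + l + 1 → ∃ p ∈ Λ, dist (z k i) p ≤ e l) :=
    fun l => hloc _ _ (he_pos l)
  obtain ⟨κ, hκ, hκP⟩ := Filter.extraction_forall_of_eventually hP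
  refine ⟨κ, fun l => -c l, hκ, fun R ε hε => ?_⟩
  obtain ⟨n₁, hn₁⟩ := exists_nat_one_div_lt (half_pos hε)
  refine Filter.eventually_atTop.2 ⟨max ⌈R⌉₊ n₁, fun l hl => ?_⟩
  have hRl : R ≤ (l : ℝ) :=
    (Nat.le_ceil R).trans (by exact_mod_cast (le_max_left _ _).trans hl)
  have hel : e l + e l ≤ ε := by
    have h1 : e l ≤ 1 / ((n₁ : ℝ) + 1) := by
      apply one_div_le_one_div_of_le (Nat.cast_add_one_pos n₁)
      have : (n₁ : ℝ) ≤ l := by exact_mod_cast (le_max_right _ _).trans hl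
      linarith
    linarith
  obtain ⟨hA, hB⟩ := hκP l
  obtain ⟨hW1, hW2⟩ := hc l
  constructor
  · intro s hs hsR
    obtain ⟨p, hp, hps⟩ := hW1 s hs (by linarith)
    have hpn : ‖p‖ ≤ ‖c l‖ + l + 1 := by
      have := norm_le_norm_add_norm_add_dist_sub p (c l) s
      linarith [he_le_one l]
    obtain ⟨i, hi⟩ := hA p hp hpn
    refine ⟨i, ?_⟩
    rw [← sub_eq_add_neg]
    calc dist (z (κ l) i - c l) s ≤ dist (z (κ l) i) p + dist (p - c l) s :=
          dist_sub_le_dist_add_dist _ _ _ _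
      _ ≤ e l + e l := add_le_add hi hps
      _ ≤ ε := hel
  · intro i hi
    rw [← sub_eq_add_neg] at hi ⊢
    have hzn : ‖z (κ l) i‖ ≤ ‖c l‖ + l + 1 := by
      have := norm_le_norm_sub_add_norm (z (κ l) i) (c l)
      linarith
    obtain ⟨p, hp, hip⟩ := hB i hzn
    have hpc : ‖p - c l‖ ≤ (l : ℝ) + 1 := by
      have := norm_sub_le_dist_add_norm_sub p (z (κ l) i) (c l)
      linarith [he_le_one l]
    obtain ⟨s, hs, hps⟩ := hW2 p hp hpc
    refine ⟨s, hs, ?_⟩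
    calc dist (z (κ l) i - c l) s ≤ dist (z (κ l) i) p + dist (p - c l) s :=
          dist_sub_le_dist_add_dist _ _ _ _
      _ ≤ e l + e l := add_le_add hip hps
      _ ≤ ε := hel

end HcpRigidityWindowsReturn

/-- **STUB B3 — windows return to the finite configurations (bookkeeping).** If finite
configurations `z_k` converge locally to a set `Λ` (two-way `ε`-matching on every ball about `0`,
eventually in `k`) and `Λ` has, for every radius and tolerance, a translated window two-way matched
with the point set of a periodic configuration `Q`, then along a subsequence and after
re-translations the `z_k` are eventually two-way `ε`-matched with `Q` on every ball.  (Stage `l`: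
window radius `l + 1`, tolerance `1/(l+1)`, window centre `c_l`; local convergence at radius
`‖c_l‖ + l + 1`; specialisation of `HcpRigidityWindowsReturn.windowsReturn_core`.) [folklore] -/
theorem stub_windowsReturn : ∀ (m : ℕ → ℕ) (z : (k : ℕ) → (Fin (m k) → EuclideanSpace ℝ (Fin 3))) (Λ : Set (EuclideanSpace ℝ (Fin 3))) (Q : Literature.MathematicalPhysics.StatisticalMechanics.PeriodicConfiguration 3), (∀ R ε : ℝ, 0 < ε → ∀ᶠ k : ℕ in Filter.atTop, (∀ p ∈ Λ, ‖p‖ ≤ R → ∃ i : Fin (m k), dist (z k i) p ≤ ε) ∧ (∀ i : Fin (m k), ‖z k i‖ ≤ R → ∃ p ∈ Λ, dist (z k i) p ≤ ε)) → (∀ R ε : ℝ, 0 < ε → ∃ c : EuclideanSpace ℝ (Fin 3), (∀ s ∈ Q.points, ‖s‖ ≤ R → ∃ p ∈ Λ, dist (p - c) s ≤ ε) ∧ (∀ p ∈ Λ, ‖p - c‖ ≤ R → ∃ s ∈ Q.points, dist (p - c) s ≤ ε)) → ∃ (κ : ℕ → ℕ) (σ : ℕ → EuclideanSpace ℝ (Fin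 3)), StrictMono κ ∧ ∀ R ε : ℝ, 0 < ε → ∀ᶠ k : ℕ in Filter.atTop, (∀ s ∈ Q.points, ‖s‖ ≤ R → ∃ i : Fin (m (κ k)), dist (z (κ k) i + σ k) s ≤ ε) ∧ (∀ i : Fin (m (κ k)), ‖z (κ k) i + σ k‖ ≤ R → ∃ s ∈ Q.points, dist (z (κ k) i + σ k) s ≤ ε) := by
  intro m z Λ Q hloc hwin
  exact HcpRigidityWindowsReturn.windowsReturn_core z Λ Q.points hloc hwin

end Summit.AtomisticToContinuum.Crystallization.Theorems
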